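import Literature.Algebra.Homology.RightDerivedFunctorPlusComp
import Literature.AlgebraicGeometry.Modules.DerivedPushforward
import Literature.AlgebraicGeometry.Modules.PushforwardIsoAdjunction
import HarnessLib

/-!
# `Rf_*` and composition: `R(q ≫ h)_* ≅ Rq_* ⋙ h_*` for `h_*` exact, `R(g ≫ q)_* ≅ g_* ⋙ Rq_*` for `g_*` exact
# preserving injectives, and BASE CHANGE OF `Rq_*` ALONG ISOMORPHISMS `g^* ⋙ Rq'_* ≅ Rq_* ⋙ h^*`
# (Hartshorne III Prop. 8.1 ∕ 9.3 shape, the trivially flat case; Weibel 10.8.3 degenerate)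

Layer `Literature/AlgebraicGeometry/Modules`; scheme-side reading of `Algebra/Homology/RightDerivedFunctorPlusComp`
for the derived direct image `derivedPushforwardPlus` of `Modules/DerivedPushforward` (everything PROVED; 0 named
facts; no instances; exactness hypotheses are instance BINDERS, discharged here for isomorphisms):

* §1 isomorphisms of schemes: `pullbackIsoPushforwardInv ε : ε^* ≅ (ε⁻¹)_*` (uniqueness of the left adjoint of `ε_*`),
  `preservesFiniteLimits_pushforward_of_iso`, `preservesFiniteColimits_pushforward_of_iso`,
  `preservesFiniteLimits_pullback_of_iso`, `injective_pushforward_obj_of_iso` (an equivalence preserves injectives).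
* §2 **`derivedPushforwardPlusCompExactIso q h : Rq_* ⋙ D⁺(h_*) ≅ R(q ≫ h)_*`** for `h_*` exact (e.g. `h` an isomorphism,
  or a closed immersion ∕ affine-and-flat… — only exactness is used);
  **`derivedPushforwardPlusExactCompIso g q : D⁺(g_*) ⋙ Rq_* ≅ R(g ≫ q)_*`** for `g_*` exact and preserving injectives.
* §3 **`derivedPushforwardPlusBaseChangeIsoOfIso q q' g h w : D⁺(g^*) ⋙ Rq'_* ≅ Rq_* ⋙ D⁺(h^*)`** for a commutative
  square `q' ≫ h = g ≫ q` whose horizontal maps `g : P' ≅ P`, `h : Y' ≅ Y` are ISOMORPHISMS (base change of the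
  derived direct image along an isomorphism of the base — the case of flat base change that needs no higher direct
  image theory), and the special cases `derivedPushforwardPlusPullbackIsoCompIso` (`D⁺(ε^*) ⋙ R(ε ≫ q)_* ≅ Rq_*`… see §3).

Typed for the cell `pub-hodge-ring2` (plate P3 of the (M1) library debt of crux 26512: the exchange rows of the
Fourier–Mukai functor move `Rp_{Â*}` past the automorphisms `t_x × 1`, `1 × t_α` of `A × Â`); a research route
conditional on HC_CM, not a corollary — nothing in this file refers to it.

## References

* R. Hartshorne, *Algebraic Geometry* (1977), II §5 p. 110 (`(g ∘ f)_* = g_* ∘ f_*`, `f^* ⊣ f_*`), III Prop. 8.1,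
  III Prop. 9.3 (flat base change; here only along isomorphisms). [Hartshorne1977]
* C. A. Weibel, *An introduction to homological algebra* (1994), 10.5.6, 10.8.2–10.8.3. [Weibel1994]
-/

noncomputable section

-- `TopCat.Presheaf`/`Scheme.Modules` are not reducible (as in Mathlib's `AlgebraicGeometry/Modules/Sheaf.lean`).
set_option backward.isDefEq.respectTransparency false

open CategoryTheory CategoryTheory.Limits AlgebraicGeometry
open AlgebraicGeometry.Scheme.Modules

universe w₁ w₂ w₃ w₄ u

namespace Literature.AlgebraicGeometry.Modules

/-! ### §1 Push-forward and pull-back along an isomorphism of schemes -/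

section Iso

variable {P P' : Scheme.{u}} (ε : P' ≅ P)

/-- **`ε^* ≅ (ε⁻¹)_*` for an isomorphism of schemes `ε`**: both are left adjoint to `ε_*` (`ε^* ⊣ ε_*` and the
equivalence `(ε⁻¹)_* ⊣ ε_*` of `Modules/PushforwardIsoAdjunction.pushforwardEquivOfIso`). The scheme-level form of the
venture HSemireg's `Summit.Ventures.HSemireg.pullbackIsoPushforwardInv` (`Summits/Ventures/HSemireg/ExtRankOfSchemeIso`,
for isomorphisms of `Over`-objects) and `pullbackIsoPushforwardInvOver` (`HomComplexSigmaOfSchemeIso`), which a later seat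
may re-point here (Literature cannot import Summits). [cite: Hartshorne1977, II §5 p. 110] -/
def pullbackIsoPushforwardInv : Scheme.Modules.pullback ε.hom ≅ pushforward ε.inv :=
  (pullbackPushforwardAdjunction ε.hom).leftAdjointUniq (pushforwardEquivOfIso ε).symm.toAdjunction

/-- `ε_*` is left exact for an isomorphism `ε` (an equivalence of categories). [cite: Hartshorne1977, II §5 p. 110] -/
theorem preservesFiniteLimits_pushforward_of_iso : PreservesFiniteLimits (pushforward ε.hom) := inferInstance

/-- `ε_*` is right exact for an isomorphism `ε`. [cite: Hartshorne1977, II §5 p. 110] -/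
theorem preservesFiniteColimits_pushforward_of_iso : PreservesFiniteColimits (pushforward ε.hom) := inferInstance

/-- `(ε⁻¹)_*` is left exact for an isomorphism `ε`. [cite: Hartshorne1977, II §5 p. 110] -/
theorem preservesFiniteLimits_pushforward_inv_of_iso : PreservesFiniteLimits (pushforward ε.inv) :=
  preservesFiniteLimits_pushforward_of_iso ε.symm

/-- `(ε⁻¹)_*` is right exact for an isomorphism `ε`. [cite: Hartshorne1977, II §5 p. 110] -/
theorem preservesFiniteColimits_pushforward_inv_of_iso : PreservesFiniteColimits (pushforward ε.inv) :=
  preservesFiniteColimits_pushforward_of_iso ε.symm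

/-- `ε^*` is left exact for an isomorphism `ε` (it is `(ε⁻¹)_*`). [cite: Hartshorne1977, II §5 p. 110] -/
theorem preservesFiniteLimits_pullback_of_iso : PreservesFiniteLimits (Scheme.Modules.pullback ε.hom) :=
  haveI := preservesFiniteLimits_pushforward_inv_of_iso ε
  preservesFiniteLimits_of_natIso (pullbackIsoPushforwardInv ε).symm

/-- **`ε_*` preserves injectives for an isomorphism `ε`** (right adjoint of the mono-preserving `(ε⁻¹)_*`).
[cite: Hartshorne1977, II §5 p. 110] -/
theorem injective_pushforward_obj_of_iso (I : P'.Modules) (hI : Injective I) : Injective ((pushforward ε.hom).obj I) :=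
  haveI := hI
  haveI := preservesFiniteLimits_pushforward_inv_of_iso ε
  Injective.injective_of_adjoint (pushforwardEquivOfIso ε).symm.toAdjunction I

end Iso

/-! ### §2 `Rq_*` composed with an exact direct image on either side -/

section Comp

variable {P' P Y Y' : Scheme.{u}} [HasDerivedCategory.{w₁} P'.Modules] [HasDerivedCategory.{w₂} P.Modules]
  [HasDerivedCategory.{w₃} Y.Modules] [HasDerivedCategory.{w₄} Y'.Modules]

/-- **`Rq_* ⋙ D⁺(h_*) ≅ R(q ≫ h)_*` when `h_*` is exact** (e.g. `h` an isomorphism): the exact `h_*` is applied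
termwise after `Rq_*` (`RightDerivedFunctorPlusComp.rightDerivedFunctorPlusCompExactIso` + Mathlib's
`pushforwardComp`). [cite: Hartshorne1977, II §5 p. 110 and III Prop. 8.1] [cite: Weibel1994, 10.8.3 (degenerate case)] -/
def derivedPushforwardPlusCompExactIso (q : P ⟶ Y) (h : Y ⟶ Y') [PreservesFiniteLimits (pushforward h)]
    [PreservesFiniteColimits (pushforward h)] :
    derivedPushforwardPlus q ⋙ (pushforward h).mapDerivedCategoryPlus ≅ derivedPushforwardPlus (q ≫ h) :=
  (pushforward q).rightDerivedFunctorPlusCompExactIso (pushforward h) ≪≫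
    Functor.rightDerivedFunctorPlusIsoOfIso _ _ (pushforwardComp q h)

/-- **`D⁺(g_*) ⋙ Rq_* ≅ R(g ≫ q)_*` when `g_*` is exact and preserves injectives** (e.g. `g` an isomorphism):
`g_*` of an injective resolution is an injective resolution. [cite: Hartshorne1977, II §5 p. 110 and III Prop. 8.1]
[cite: Weibel1994, 10.8.2–10.8.3 (degenerate case)] -/
def derivedPushforwardPlusExactCompIso (g : P' ⟶ P) (q : P ⟶ Y) [PreservesFiniteLimits (pushforward g)]
    [PreservesFiniteColimits (pushforward g)] (hg : ∀ I : P'.Modules, Injective I → Injective ((pushforward g).obj I)) :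
    (pushforward g).mapDerivedCategoryPlus ⋙ derivedPushforwardPlus q ≅ derivedPushforwardPlus (g ≫ q) :=
  (pushforward g).rightDerivedFunctorPlusExactCompIso hg (pushforward q) ≪≫
    Functor.rightDerivedFunctorPlusIsoOfIso _ _ (pushforwardComp g q)

end Comp

/-! ### §3 Base change of `Rq_*` along isomorphisms -/

section BaseChange

variable {P' P Y Y' : Scheme.{u}} [HasDerivedCategory.{w₁} P'.Modules] [HasDerivedCategory.{w₂} P.Modules]
  [HasDerivedCategory.{w₃} Y.Modules] [HasDerivedCategory.{w₄} Y'.Modules]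

/-- **`D⁺(ε_*) ⋙ Rq_* ≅ R(ε ≫ q)_*` for an isomorphism `ε : P' ≅ P`.** [cite: Hartshorne1977, II §5 p. 110 and III Prop. 8.1] -/
def derivedPushforwardPlusIsoCompIso (ε : P' ≅ P) (q : P ⟶ Y) :
    (haveI := preservesFiniteLimits_pushforward_of_iso ε
     haveI := preservesFiniteColimits_pushforward_of_iso ε
     (pushforward ε.hom).mapDerivedCategoryPlus ⋙ derivedPushforwardPlus q) ≅ derivedPushforwardPlus (ε.hom ≫ q) :=
  haveI := preservesFiniteLimits_pushforward_of_iso ε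
  haveI := preservesFiniteColimits_pushforward_of_iso ε
  derivedPushforwardPlusExactCompIso ε.hom q (injective_pushforward_obj_of_iso ε)

/-- **`Rq_* ⋙ D⁺(ε_*) ≅ R(q ≫ ε)_*` for an isomorphism `ε : Y ≅ Y'`.** [cite: Hartshorne1977, II §5 p. 110 and III Prop. 8.1] -/
def derivedPushforwardPlusCompIsoIso (q : P ⟶ Y) (ε : Y ≅ Y') :
    (haveI := preservesFiniteLimits_pushforward_of_iso ε
     haveI := preservesFiniteColimits_pushforward_of_iso ε
     derivedPushforwardPlus q ⋙ (pushforward ε.hom).mapDerivedCategoryPlus) ≅ derivedPushforwardPlus (q ≫ ε.hom) :=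
  haveI := preservesFiniteLimits_pushforward_of_iso ε
  haveI := preservesFiniteColimits_pushforward_of_iso ε
  derivedPushforwardPlusCompExactIso q ε.hom

/-- **BASE CHANGE OF THE DERIVED DIRECT IMAGE ALONG AN ISOMORPHISM OF THE BASE**: for a commutative square
`q' ≫ h = g ≫ q` of schemes whose horizontal maps `g : P' ≅ P` and `h : Y' ≅ Y` are isomorphisms,
`D⁺(g^*) ⋙ Rq'_* ≅ Rq_* ⋙ D⁺(h^*)` as functors `D⁺(Mod 𝒪_P) ⥤ D⁺(Mod 𝒪_{Y'})` — `g^* = (g⁻¹)_*` preserves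
injectives and `g⁻¹ ≫ q' = q ≫ h⁻¹`, so both sides are `R(q ≫ h⁻¹)_*`. (The flat base change theorem in the one
case that needs no cohomology.) The pull-backs' exactness instances are binders (discharge with
`preservesFiniteLimits_pullback_of_iso`; right exactness is automatic). [cite: Hartshorne1977, III Prop. 9.3 (flat base change; here along an isomorphism)]
[cite: Weibel1994, 10.8.2–10.8.3] -/
def derivedPushforwardPlusBaseChangeIsoOfIso (q : P ⟶ Y) (q' : P' ⟶ Y') (g : P' ≅ P) (h : Y' ≅ Y)
    (w : q' ≫ h.hom = g.hom ≫ q) [PreservesFiniteLimits (Scheme.Modules.pullback g.hom)]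
    [PreservesFiniteLimits (Scheme.Modules.pullback h.hom)] :
    (Scheme.Modules.pullback g.hom).mapDerivedCategoryPlus ⋙ derivedPushforwardPlus q' ≅
      derivedPushforwardPlus q ⋙ (Scheme.Modules.pullback h.hom).mapDerivedCategoryPlus :=
  haveI := preservesFiniteLimits_pushforward_inv_of_iso g
  haveI := preservesFiniteColimits_pushforward_inv_of_iso g
  haveI := preservesFiniteLimits_pushforward_inv_of_iso h
  haveI := preservesFiniteColimits_pushforward_inv_of_iso h
  have w' : g.inv ≫ q' = q ≫ h.inv := by
    rw [← cancel_mono h.hom, Category.assoc, Category.assoc, w, Iso.inv_hom_id_assoc, Iso.inv_hom_id, Category.comp_id]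
  Functor.isoWhiskerRight (Functor.mapDerivedCategoryPlusIsoOfIso _ _ (pullbackIsoPushforwardInv g)) _ ≪≫
    derivedPushforwardPlusExactCompIso g.inv q' (injective_pushforward_obj_of_iso g.symm) ≪≫
    Functor.rightDerivedFunctorPlusIsoOfIso _ _ (pushforwardCongr w') ≪≫
    (derivedPushforwardPlusCompExactIso q h.inv).symm ≪≫
    Functor.isoWhiskerLeft _ (Functor.mapDerivedCategoryPlusIsoOfIso _ _ (pullbackIsoPushforwardInv h)).symm

end BaseChange

end Literature.AlgebraicGeometry.Modules

end
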